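import Summits.QuantumFields.BalabanUV.Beta.FP.CoarseCovarianceStripBn

/-!
# `BalabanUV.Beta.FP.CoarseCovarianceInverse` — road «FP» (binder row D1), row H′2-IR ∕ IR-2 (iv)+(v): **THE INVERSE OF THE COARSE COVARIANCE
# SYMBOL IS STRIP-REGULAR, n-UNIFORMLY, AND ITS COARSE LATTICE KERNEL DECAYS EXPONENTIALLY** —
# `StripRegular (k ↦ GC n k α β) κ_C (CG·n^{D−2})` and **`‖latticeKernel (GC n · α β) x‖ ≤ CG·n^{D−2}·e^{−κ_C‖x‖∞}`**, every `n ≥ 1`, every `x ∈ ℤ^D`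
# (`D = d+1`; `n^{D−2}` is written `n^d/n`; `κ_C = kapC d`, `CG = CG d` depend on `d` only); `GC·Ĉ_n = Ĉ_n·GC = 1` on the punctured real zone, `GC(0) = 0`

HONEST FRAMING (cell contract, verbatim): «discharging `BetaPertH` makes Bałaban's UV stability UNCONDITIONAL — a real constructive-QFT
result; it is NOT the continuum limit and NOT the Clay problem.»  HONEST DEPENDENCY (verbatim): «continuum YM on T⁴ ⇐ BetaPertH ∧ nine
spine estimates (0/9 proved); BetaPertH ⇐ (D1) ∧ (D4) ∧ CAP+tail; G-an2-4 gates asym, D1 and NE2/3/4.»  THIS MODULE DISCHARGES NOTHING of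
D1 ∕ BetaPertH: [folklore] bookkeeping over files (ii)(Bound)(Reg)(Bn) of this row and the tree's `B4ContourShift.latticeKernel_decay` (the
analyticity method: strip-regular symbol ⟹ exponentially decaying lattice kernel) BY NAME.  One [our object] CONSTANT def (`CG`, `d`-only); no
`def … : Prop`; nothing is cited; 0 sorry.  NOT summit progress; NOT BetaPertH, NOT continuum, NOT Clay.

ABSOLUTE RULE (cell, verbatim): «No internally-minted statement may enter as a cited fact. Every hypothesis is either kernel-proved in this
package or a verbatim quotation of a PUBLISHED theorem with page reference. The manuscript(s) under audit are NOT citable for their own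
disputed steps — they are the thing under adjudication; programme-internal (2001/route/tribunal) claims are never citable.»

CONTENT (`D = d+1`; owner design memo `HOME/b2b-balaban-beta-d1-p3/H2IR-DESIGN.md` §IR-2 (iv)–(v): `|G_C(u,v)| ≤ C n² e^{−δ|u−v|}` at `D = 4`).
* §1 on the thin strip `Strip D κ_C`: `strip_mem_Fat`, **`continuousOn_GC`** (matrix-valued), `CG`, **`norm_GC_le`** (`‖GC n k α β‖ ≤ CG·n^d/n`),
  `insertNth_eq_update`, **`differentiableAt_GC_update`** (slice holomorphy at every strip point), `feynC_update_add_two_pi`, `PC_update_add_two_pi`,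
  `Chol_update_add_two_pi` (the symbol of record is `2π`-periodic), `pi_div_le_redist_side`, `isUnit_feynC_side`, **`GC_sides`**.
* §2 **`stripRegular_GC`** and THE CLAIM **`norm_latticeKernel_GC_le`**.
* §3 the real punctured zone: **`GC_mul_Chol_real`**, **`Chol_mul_GC_real`**, `GC_real_eq_inv` (`GC = Ĉ_n⁻¹`), and `GC_zero` (file (ii)).
Unit `b2b-balaban-beta-d1-formalise-leaf-06` (gen 8), owner ruling R-FP-21 (A3)∕(C).
-/

noncomputable section

namespace Summit.QuantumFields.BalabanUV.Beta.FP.CoarseCovarianceInverse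

open Finset Complex Set Metric Matrix
open scoped BigOperators ComplexConjugate
open Literature.MathematicalPhysics.QuantumFieldTheory.Balaban1983to89
open B4Strip (Strip ofRealVec reVec)
open B4StripCauchy (Fat strip_subset_fat)
open B4ContourShift (BZ StripRegular latticeKernel supNorm closedRect openRect insertNth_mem_Strip latticeKernel_decay)
open Summit.QuantumFields.BalabanUV.Beta.GAN24.AliasDecimate (aliasPt)
open Summit.QuantumFields.BalabanUV.Beta.GAN24.PushSumSymbol (cweight)
open Summit.QuantumFields.BalabanUV.Beta.FP.CoarseCovarianceAlias (covSymMean covSymMean_periodic)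
open Summit.QuantumFields.BalabanUV.Beta.FP.CoarseCovarianceStripW
open Summit.QuantumFields.BalabanUV.Beta.FP.CoarseCovarianceStripFeyn
open Summit.QuantumFields.BalabanUV.Beta.FP.CoarseCovarianceStripProp
open Summit.QuantumFields.BalabanUV.Beta.FP.CoarseCovarianceStripPropCone
open Summit.QuantumFields.BalabanUV.Beta.FP.CoarseCovarianceStripAlias
open Summit.QuantumFields.BalabanUV.Beta.FP.CoarseCovarianceStripAliasWeights (aliasPt_apply' aliasPt_im)
open Summit.QuantumFields.BalabanUV.Beta.FP.CoarseCovarianceStrip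
open Summit.QuantumFields.BalabanUV.Beta.FP.CoarseCovarianceStripBound
open Summit.QuantumFields.BalabanUV.Beta.FP.CoarseCovarianceStripCalculus
open Summit.QuantumFields.BalabanUV.Beta.FP.CoarseCovarianceStripReg
open Summit.QuantumFields.BalabanUV.Beta.FP.CoarseCovarianceStripBn

variable {d : ℕ}

/-! ## §1 The inverse symbol on the thin strip -/

/-- [folklore] the thin strip lies in the fat region `Fat D rA`. -/
theorem strip_mem_Fat {k : Fin (d + 1) → ℂ} (hk : k ∈ Strip (d + 1) (kapC d)) : k ∈ Fat (d + 1) (rA d) :=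
  strip_subset_fat (rA_pos d).le (kapC_le_rA d) hk

/-- [our object] **`k ↦ GC n k` IS CONTINUOUS ON THE THIN STRIP** (matrix-valued; `Bn⁻¹` continuous where `det Bn ≠ 0`). -/
theorem continuousOn_GC (n : ℕ) [NeZero n] : ContinuousOn (fun k : Fin (d + 1) → ℂ => GC n k) (Strip (d + 1) (kapC d)) := by
  have hsub : Strip (d + 1) (kapC d) ⊆ Fat (d + 1) (rA d) := fun k hk => strip_mem_Fat hk
  have hBi : ContinuousOn (fun k : Fin (d + 1) → ℂ => (Bn n k)⁻¹) (Strip (d + 1) (kapC d)) :=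
    continuousOn_matrix_inv_of_det ((continuousOn_Bn n).mono hsub) fun k hk => (Bn_inv_bound n hk).1.ne_zero
  unfold GC
  exact (((((continuousOn_Dwmi_zero n).mono hsub).mul hBi).mul ((continuousOn_feynC_alias n _).mono hsub)).mul
    ((continuousOn_Dwi_zero n).mono hsub)).const_smul ((n : ℂ) ^ (3 * (d + 1) + 2))

/-- [our object] the inverse-symbol constant `CG := D·CB·MF2/c0^{2D+2}`. -/
def CG (d : ℕ) : ℝ := ((d : ℝ) + 1) * CB d * MF2 d / c0 d ^ (2 * (d + 2))

/-- [folklore] `0 < CG`. -/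
theorem CG_pos (d : ℕ) : 0 < CG d := by
  unfold CG; have := CB_pos d; have := MF2_pos d; have := c0_pos d; positivity

/-- [our object] **`‖GC n k α β‖ ≤ CG·n^{D−2}`** (written `CG·(n^d/n)`) on the thin strip, every `n ≥ 1`
(`N·(c0 n)^{−(D+1)}·CB·(MF2/n²)·(c0 n)^{−(D+1)}·D`). -/
theorem norm_GC_le (n : ℕ) [NeZero n] {k : Fin (d + 1) → ℂ} (hk : k ∈ Strip (d + 1) (kapC d)) (α β : Fin (d + 1)) :
    ‖GC n k α β‖ ≤ CG d * ((n : ℝ) ^ d / n) := by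
  have hn : (0 : ℝ) < n := by exact_mod_cast Nat.pos_of_ne_zero (NeZero.ne n)
  have hkF := strip_mem_Fat hk
  have hc := c0_pos d
  have hM := MF2_pos d
  have hB := CB_pos d
  obtain ⟨_, hBi⟩ := Bn_inv_bound n hk
  set W : ℝ := ((c0 d * n) ^ (d + 2))⁻¹ with hW
  have hW0 : 0 ≤ W := by positivity
  rw [GC_apply, norm_mul, norm_mul, norm_pow, Complex.norm_natCast]
  have hsum : ‖∑ κ, (cweight n α (-aliasPt n (fun _ => (0 : Fin n)) k))⁻¹ * (Bn n k)⁻¹ α κ * feynC (aliasPt n (fun _ => (0 : Fin n)) k) κ β‖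
      ≤ ((d : ℝ) + 1) * (W * CB d * (MF2 d / (n : ℝ) ^ 2)) := by
    calc _ ≤ ∑ κ, ‖(cweight n α (-aliasPt n (fun _ => (0 : Fin n)) k))⁻¹ * (Bn n k)⁻¹ α κ * feynC (aliasPt n (fun _ => (0 : Fin n)) k) κ β‖ :=
          norm_sum_le _ _
      _ ≤ ∑ _κ : Fin (d + 1), W * CB d * (MF2 d / (n : ℝ) ^ 2) := Finset.sum_le_sum fun κ _ => by
          rw [norm_mul, norm_mul]
          exact mul_le_mul (mul_le_mul (norm_cwm0_inv_le n hkF α) (hBi α κ) (norm_nonneg _) hW0) (norm_feynC_zero_alias_le n hkF κ β)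
            (norm_nonneg _) (by positivity)
      _ = _ := by simp only [Finset.sum_const, Finset.card_univ, Fintype.card_fin, nsmul_eq_mul]; push_cast; ring
  calc (n : ℝ) ^ (3 * (d + 1) + 2) * (_ * ‖(cweight n β (aliasPt n (fun _ => (0 : Fin n)) k))⁻¹‖)
      ≤ (n : ℝ) ^ (3 * (d + 1) + 2) * (((d : ℝ) + 1) * (W * CB d * (MF2 d / (n : ℝ) ^ 2)) * W) := by
        refine mul_le_mul_of_nonneg_left (mul_le_mul hsum (norm_cw0_inv_le n hkF β) (norm_nonneg _) (by positivity)) (by positivity)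
    _ = CG d * ((n : ℝ) ^ d / n) := by
        rw [hW, CG]
        field_simp
        ring

/-- [folklore] inserting `z` at coordinate `i` is updating coordinate `i` of the insertion of any `z₀`. -/
theorem insertNth_eq_update (i : Fin (d + 1)) (z z₀ : ℂ) (r : Fin d → ℂ) :
    (i.insertNth z r : Fin (d + 1) → ℂ) = Function.update (i.insertNth z₀ r : Fin (d + 1) → ℂ) i z := by
  rw [Fin.update_insertNth]

/-- [our object] **`GC` IS HOLOMORPHIC IN EACH COORDINATE SLICE AT EVERY POINT OF THE THIN STRIP**. -/
theorem differentiableAt_GC_update (n : ℕ) [NeZero n] {p : Fin (d + 1) → ℂ} (hp : p ∈ Strip (d + 1) (kapC d)) (i α β : Fin (d + 1)) :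
    DifferentiableAt ℂ (fun w => GC n (Function.update p i w) α β) (p i) := by
  have hpF := strip_mem_Fat hp
  unfold GC
  refine differentiableAt_smul_apply (differentiableAt_mul_apply (differentiableAt_mul_apply (differentiableAt_mul_apply ?_ ?_) ?_) ?_) _ α β
  · intro a b
    unfold Dwmi
    refine differentiableAt_diagonal_apply (fun lam => (differentiableAt_cweight_neg_alias_update n lam _ p i _).inv ?_) a b
    simp only [Function.update_eq_self]
    exact cwm0_ne n hpF lam
  · intro a b
    refine differentiableAt_inv_apply (A := fun w => Bn n (Function.update p i w)) (fun a' b' => ?_) ?_ a b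
    · unfold Bn
      exact differentiableAt_one_add_apply (fun a'' b'' => differentiableAt_En_update n hpF i a'' b'') a' b'
    · simp only [Function.update_eq_self]
      exact (Bn_inv_bound n hp).1.ne_zero
  · exact fun a b => differentiableAt_feynC_alias_update n hpF _ i a b
  · intro a b
    unfold Dwi
    refine differentiableAt_diagonal_apply (fun κ => (differentiableAt_cweight_alias_update n κ _ p i _).inv ?_) a b
    simp only [Function.update_eq_self]
    exact cw0_ne n hpF κ

/-- [folklore] the Feynman matrix is `2π`-periodic in each coordinate. -/
theorem feynC_update_add_two_pi (p : Fin (d + 1) → ℂ) (j : Fin (d + 1)) :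
    feynC (Function.update p j (p j + 2 * Real.pi)) = feynC p := by
  rw [← feynC_wrapC (Function.update p j (p j + 2 * Real.pi)), wrapC_update, wrapRe_add_two_pi, ← wrapC_apply, Function.update_eq_self,
    feynC_wrapC]

/-- [folklore] the perfect propagator symbol is `2π`-periodic in each coordinate. -/
theorem PC_update_add_two_pi (p : Fin (d + 1) → ℂ) (j : Fin (d + 1)) : PC (Function.update p j (p j + 2 * Real.pi)) = PC p := by
  rw [PC, PC, feynC_update_add_two_pi]

/-- [our object] **THE SYMBOL OF RECORD IS `2π`-PERIODIC IN EACH COARSE COORDINATE** (`covSymMean_periodic` BY NAME). -/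
theorem Chol_update_add_two_pi (n : ℕ) [NeZero n] (k : Fin (d + 1) → ℂ) (i : Fin (d + 1)) :
    Chol n (Function.update k i (k i + 2 * Real.pi)) = Chol n k := by
  ext κ lam
  rw [Chol_apply, Chol_apply]
  exact covSymMean_periodic n κ lam (fun j P => by simp only [PC_update_add_two_pi]) i k

/-- [folklore] a point with one real coordinate `= ±π` has `π/n ≤ redist (k/n)`. -/
theorem pi_div_le_redist_side (n : ℕ) [NeZero n] {k : Fin (d + 1) → ℂ} {i : Fin (d + 1)}
    (h : (k i).re = Real.pi ∨ (k i).re = -Real.pi) : Real.pi / n ≤ redist (aliasPt n (fun _ => (0 : Fin n)) k) := by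
  have hn : (0 : ℝ) < n := by exact_mod_cast Nat.pos_of_ne_zero (NeZero.ne n)
  have hn1 : (1 : ℝ) ≤ n := by exact_mod_cast Nat.one_le_iff_ne_zero.mpr (NeZero.ne n)
  have hπ := Real.pi_pos
  refine le_trans ?_ (abs_re_wrapC_le (aliasPt n (fun _ => (0 : Fin n)) k) i)
  rw [wrapC_apply, wrapRe_re, aliasPt_re]
  simp only [Fin.val_zero, Nat.cast_zero, mul_zero, add_zero]
  have hle : Real.pi / n ≤ 2 * Real.pi - Real.pi / n := by
    have : Real.pi / n ≤ Real.pi := div_le_self hπ.le hn1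
    linarith
  rcases h with h | h
  · rw [h]
    exact abs_toIocMod_ge le_rfl hle
  · rw [h, show -Real.pi / (n : ℝ) = (2 * Real.pi - Real.pi / n) + (-1 : ℤ) • (2 * Real.pi) by rw [neg_one_zsmul]; ring,
      toIocMod_add_zsmul]
    exact abs_toIocMod_ge hle le_rfl

/-- [our object] at a strip point with one real coordinate `= ±π` the `l = 0` Feynman matrix is invertible (cone theorem at `redist ≥ π/n`). -/
theorem isUnit_feynC_side (n : ℕ) [NeZero n] {k : Fin (d + 1) → ℂ} (hk : k ∈ Strip (d + 1) (kapC d)) {i : Fin (d + 1)}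
    (h : (k i).re = Real.pi ∨ (k i).re = -Real.pi) : IsUnit (feynC (aliasPt n (fun _ => (0 : Fin n)) k)).det := by
  have hn : (0 : ℝ) < n := by exact_mod_cast Nat.pos_of_ne_zero (NeZero.ne n)
  have hred := pi_div_le_redist_side n h
  have hπ := Real.pi_gt_three
  have hpos : 0 < redist (aliasPt n (fun _ => (0 : Fin n)) k) := lt_of_lt_of_le (by positivity) hred
  refine (PC_bound_cone (fun j => ?_) (fun j => ?_) hpos).1
  · rw [aliasPt_im, abs_div, Nat.abs_cast]
    calc |(k j).im| / n ≤ |(k j).im| := div_le_self (abs_nonneg _) (by exact_mod_cast Nat.one_le_iff_ne_zero.mpr (NeZero.ne n))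
      _ ≤ kap0 d := ((hk j).2.trans (kapC_le_rA d)).trans (by linarith [two_rA_le_kap0 d, rA_pos d])
  · rw [aliasPt_im, abs_div, Nat.abs_cast]
    have hc := cone_pos d
    have h1 : |(k j).im| ≤ cone d * Real.pi := ((hk j).2.trans (kapC_le_rA d)).trans ((rA_le_cone d).trans (by nlinarith))
    calc |(k j).im| / n ≤ cone d * Real.pi / n := by gcongr
      _ = cone d * (Real.pi / n) := by ring
      _ ≤ cone d * redist (aliasPt n (fun _ => (0 : Fin n)) k) := mul_le_mul_of_nonneg_left hred hc.le

/-- [our object] **THE SIDE CONDITION**: the values of `GC` on the two vertical sides `Re k_i = ∓π` of the strip agree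
(there `GC = Chol⁻¹`, and `Chol` is `2π`-periodic). -/
theorem GC_sides (n : ℕ) [NeZero n] (α β i : Fin (d + 1)) {q : Fin d → ℝ} (hq : q ∈ BZ d) {y : ℝ} (hy : |y| ≤ kapC d) :
    GC n (i.insertNth (-Real.pi + y * I) (ofRealVec q)) α β = GC n (i.insertNth (Real.pi + y * I) (ofRealVec q)) α β := by
  have hκ := (kapC_pos d).le
  have hπ := Real.pi_pos
  have hym : y ∈ Set.uIcc (-kapC d) (kapC d) := by
    rw [Set.uIcc_of_le (by linarith)]; exact ⟨(abs_le.mp hy).1, (abs_le.mp hy).2⟩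
  have hxm : ∀ s : ℝ, s = Real.pi ∨ s = -Real.pi → s ∈ Set.uIcc (-Real.pi) Real.pi := fun s hs => by
    rw [Set.uIcc_of_le (by linarith)]
    rcases hs with hs | hs <;> rw [hs] <;> constructor <;> linarith
  have hm1 : (-(Real.pi : ℂ) + y * I) ∈ closedRect (kapC d) := by
    refine ⟨?_, ?_⟩ <;> simp only [Set.mem_preimage, Complex.add_re, Complex.neg_re, Complex.ofReal_re, Complex.mul_re, Complex.I_re,
      Complex.ofReal_im, Complex.I_im, mul_zero, mul_one, sub_zero, add_zero, Complex.add_im, Complex.neg_im, Complex.mul_im, zero_add, neg_zero]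
    · exact hxm _ (Or.inr rfl)
    · exact hym
  have hm2 : ((Real.pi : ℂ) + y * I) ∈ closedRect (kapC d) := by
    refine ⟨?_, ?_⟩ <;> simp only [Set.mem_preimage, Complex.add_re, Complex.ofReal_re, Complex.mul_re, Complex.I_re,
      Complex.ofReal_im, Complex.I_im, mul_zero, mul_one, sub_zero, add_zero, Complex.add_im, Complex.mul_im, zero_add]
    · exact hxm _ (Or.inl rfl)
    · exact hym
  set km : Fin (d + 1) → ℂ := i.insertNth (-(Real.pi : ℂ) + y * I) (ofRealVec q) with hkm
  set kp : Fin (d + 1) → ℂ := i.insertNth ((Real.pi : ℂ) + y * I) (ofRealVec q) with hkp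
  have hkmS : km ∈ Strip (d + 1) (kapC d) := insertNth_mem_Strip hκ i hq hm1
  have hkpS : kp ∈ Strip (d + 1) (kapC d) := insertNth_mem_Strip hκ i hq hm2
  have hkmi : km i = -(Real.pi : ℂ) + y * I := by rw [hkm, Fin.insertNth_apply_same]
  have hkpi : kp i = (Real.pi : ℂ) + y * I := by rw [hkp, Fin.insertNth_apply_same]
  have hrem : (km i).re = -Real.pi := by rw [hkmi]; simp
  have hrep : (kp i).re = Real.pi := by rw [hkpi]; simp
  have hshift : kp = Function.update km i (km i + 2 * Real.pi) := by
    rw [hkmi, hkp, hkm, Fin.update_insertNth]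
    congr 1
    ring
  have hGm : GC n km = (Chol n km)⁻¹ :=
    GC_eq_Chol_inv n (strip_mem_Fat hkmS) (isUnit_feynC_side n hkmS (Or.inr hrem)) (Bn_inv_bound n hkmS).1
  have hGp : GC n kp = (Chol n kp)⁻¹ :=
    GC_eq_Chol_inv n (strip_mem_Fat hkpS) (isUnit_feynC_side n hkpS (Or.inl hrep)) (Bn_inv_bound n hkpS).1
  have hC : Chol n kp = Chol n km := by rw [hshift, Chol_update_add_two_pi]
  show GC n km α β = GC n kp α β
  rw [hGm, hGp, hC]

/-! ## §2 Strip regularity and the decay of the coarse lattice kernel -/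

/-- [our object] **THE ENTRIES OF THE INVERSE SYMBOL ARE STRIP-REGULAR, n-UNIFORMLY**: `StripRegular (GC n · α β) κ_C (CG·n^d/n)`. -/
theorem stripRegular_GC (n : ℕ) [NeZero n] (α β : Fin (d + 1)) :
    StripRegular (fun k : Fin (d + 1) → ℂ => GC n k α β) (kapC d) (CG d * ((n : ℝ) ^ d / n)) := by
  refine ⟨continuousOn_entry_of_matrix (continuousOn_GC n) α β, fun i q hq => ?_, fun i q hq y hy => GC_sides n α β i hq hy,
    fun k hk => norm_GC_le n hk α β⟩
  intro z hz
  have hzc : z ∈ closedRect (kapC d) := B4ContourShift.openRect_subset_closedRect _ hz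
  have hP : i.insertNth z (ofRealVec q) ∈ Strip (d + 1) (kapC d) := insertNth_mem_Strip (kapC_pos d).le i hq hzc
  have h := differentiableAt_GC_update n hP i α β
  rw [Fin.insertNth_apply_same] at h
  have e : (fun w : ℂ => GC n (i.insertNth w (ofRealVec q)) α β) = fun w => GC n (Function.update (i.insertNth z (ofRealVec q)) i w) α β := by
    funext w; rw [insertNth_eq_update i w z]
  rw [e]
  exact h.differentiableWithinAt

/-- [our object] **THE CLAIM (IR-2 (v))**: the coarse lattice kernel of the inverse symbol decays exponentially, n-uniformly —
`‖latticeKernel (GC n · α β) x‖ ≤ CG·(n^d/n)·e^{−κ_C·‖x‖∞}` for every `n ≥ 1`, `x ∈ ℤ^D` (at `D = 4`: `≤ CG·n²·e^{−κ_C‖x‖∞}`). -/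
theorem norm_latticeKernel_GC_le (n : ℕ) [NeZero n] (α β : Fin (d + 1)) (x : Fin (d + 1) → ℤ) :
    ‖latticeKernel (fun k : Fin (d + 1) → ℂ => GC n k α β) x‖ ≤ CG d * ((n : ℝ) ^ d / n) * Real.exp (-(kapC d * supNorm x)) :=
  latticeKernel_decay (stripRegular_GC n α β) (kapC_pos d).le x

/-! ## §3 The real punctured zone: `GC` is the two-sided inverse of the symbol of record -/

/-- [our object] **`GC·Ĉ_n = 1` AT EVERY REAL ZONE MOMENTUM `t ≠ 0`.** -/
theorem GC_mul_Chol_real (n : ℕ) [NeZero n] {t : Fin (d + 1) → ℝ} (ht : t ∈ BZ (d + 1)) (ht0 : t ≠ 0) :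
    GC n (ofRealVec t) * Chol n (ofRealVec t) = 1 :=
  GC_mul_Chol n (ofRealVec_mem_Fat ht (rA_pos d).le) (PC_real_bound n ht ht0).1 (Bn_inv_real n ht).1

/-- [our object] **`Ĉ_n·GC = 1` AT EVERY REAL ZONE MOMENTUM `t ≠ 0`.** -/
theorem Chol_mul_GC_real (n : ℕ) [NeZero n] {t : Fin (d + 1) → ℝ} (ht : t ∈ BZ (d + 1)) (ht0 : t ≠ 0) :
    Chol n (ofRealVec t) * GC n (ofRealVec t) = 1 :=
  Chol_mul_GC n (ofRealVec_mem_Fat ht (rA_pos d).le) (PC_real_bound n ht ht0).1 (Bn_inv_real n ht).1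

/-- [our object] hence `GC = Ĉ_n⁻¹` on the punctured real zone (and `GC n 0 = 0`, file (ii) `GC_zero`). -/
theorem GC_real_eq_inv (n : ℕ) [NeZero n] {t : Fin (d + 1) → ℝ} (ht : t ∈ BZ (d + 1)) (ht0 : t ≠ 0) :
    GC n (ofRealVec t) = (Chol n (ofRealVec t))⁻¹ :=
  GC_eq_Chol_inv n (ofRealVec_mem_Fat ht (rA_pos d).le) (PC_real_bound n ht ht0).1 (Bn_inv_real n ht).1

/-- [our object] and `Ĉ_n` is invertible there, with `Ĉ_n⁻¹` entries `≤ CG·n^d/n`. -/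
theorem norm_Chol_inv_real_le (n : ℕ) [NeZero n] {t : Fin (d + 1) → ℝ} (ht : t ∈ BZ (d + 1)) (ht0 : t ≠ 0) (α β : Fin (d + 1)) :
    ‖(Chol n (ofRealVec t))⁻¹ α β‖ ≤ CG d * ((n : ℝ) ^ d / n) := by
  rw [← GC_real_eq_inv n ht ht0]
  exact norm_GC_le n (B4ContourShift.ofRealVec_mem_Strip (kapC_pos d).le ht) α β

end Summit.QuantumFields.BalabanUV.Beta.FP.CoarseCovarianceInverse

end
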